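import Mathlib
import Literature.NumberTheory.Transcendental.SemialgebraicMapsProofs
import Literature.NumberTheory.Transcendental.KZIntervalPeriodProofs
import Summits.KontsevichZagierPeriods.KontsevichZagierPeriods.Theorems.SoloInformedLastSubst
import HarnessLib
import HarnessLib.Audit

/-!
# The fibre scaling map `Ψ(x, t) = (Φ x, t · h x)` (solo-informed residency, K-NF.2 file C2a)

Sorry-free toolkit for the density-removal step of COROLLARY NF.2 (`paper/nl-elimination.md` of
the residency): for a change of variables `Φ` of `ℝⁿ` with Jacobian `J = |det Φ'|` the region under
the graph of `f = (g ∘ Φ) · J` is carried onto the region under the graph of `g` by the single map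

  `Ψ(x, t) := (Φ x, t / J x)`,

which is block lower-triangular with `|det DΨ| = |det Φ'| · J⁻¹ = 1`.  We factor `Ψ` as the
last-coordinate substitution `(x, t) ↦ (x, t · h x)` (tree file `SoloInformedLastSubst`,
`h = J⁻¹`) followed by the block map `(x, s) ↦ (Φ x, s)`; derivatives compose by the chain rule and
determinants multiply.

* `soloInformedSplitEquiv` — the linear splitting `ℝⁿ × ℝ¹ ≃L ℝⁿ⁺¹`;
* `soloInformedInitBlock Φ`, `soloInformedInitBlockDeriv A` — the block map `(x, s) ↦ (Φ x, s)`,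
  its derivative, `det = det A`, `HasFDerivAt`;
* `soloInformedFibreScale h`, `soloInformedFibreScaleDeriv` — `(x, t) ↦ t · h x` and its derivative;
* `soloInformedFibreMap Φ h`, `soloInformedFibreMapDeriv` — the composite, `HasFDerivAt`,
  `det = det A · h x`, `|det| = 1` for `h = |det Φ'|⁻¹`, injectivity, `ℚ`-semialgebraicity.

[Kontsevich–Zagier 2001, §1.2 rule (2)] [this work, COROLLARY NF.2]
-/

noncomputable section

open scoped BigOperators Topology

namespace Summit.KontsevichZagierPeriods.KontsevichZagierPeriods.Theorems

open Set MeasureTheory Function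
open Literature.ModelTheory.ExponentialFields (IsSemialgebraic)
open Literature.NumberTheory.Transcendental

variable {n : ℕ}

/-! ### The coordinate splitting `ℝⁿ × ℝ¹ ≃ ℝⁿ⁺¹` -/

/-- The linear splitting `(x, y) ↦ Fin.append x y : ℝⁿ × ℝ¹ → ℝⁿ⁺¹`. -/
def soloInformedSplitLinearEquiv (n : ℕ) : ((Fin n → ℝ) × (Fin 1 → ℝ)) ≃ₗ[ℝ] (Fin (n + 1) → ℝ) where
  toFun p := Fin.append p.1 p.2
  invFun z := (fun i => z (Fin.castAdd 1 i), fun j => z (Fin.natAdd n j))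
  map_add' p q := by
    ext i; refine Fin.addCases (fun i => ?_) (fun j => ?_) i <;> simp
  map_smul' c p := by
    ext i; refine Fin.addCases (fun i => ?_) (fun j => ?_) i <;> simp
  left_inv p := by ext <;> simp
  right_inv z := by
    ext i; refine Fin.addCases (fun i => ?_) (fun j => ?_) i <;> simp

/-- The continuous linear splitting `ℝⁿ × ℝ¹ ≃L ℝⁿ⁺¹`. -/
def soloInformedSplitEquiv (n : ℕ) : ((Fin n → ℝ) × (Fin 1 → ℝ)) ≃L[ℝ] (Fin (n + 1) → ℝ) :=
  (soloInformedSplitLinearEquiv n).toContinuousLinearEquiv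

/-- The splitting sends `(x, y)` to `Fin.snoc x (y 0)`. -/
theorem soloInformed_splitEquiv_apply (p : (Fin n → ℝ) × (Fin 1 → ℝ)) :
    soloInformedSplitEquiv n p = Fin.snoc p.1 (p.2 0) :=
  Fin.append_right_eq_snoc _ _

/-- The inverse splitting sends `z` to `(init z, last z)`. -/
theorem soloInformed_splitEquiv_symm_apply (z : Fin (n + 1) → ℝ) :
    (soloInformedSplitEquiv n).symm z = (Fin.init z, fun _ => z (Fin.last n)) := by
  refine Prod.ext rfl (funext fun j => ?_)
  show z (Fin.natAdd n j) = z (Fin.last n)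
  rw [Subsingleton.elim j 0]
  rfl

/-! ### The block map `(x, s) ↦ (Φ x, s)` -/

/-- The block map `Θ_Φ (x, s) := (Φ x, s)` on `ℝⁿ⁺¹ = ℝⁿ × ℝ`. -/
def soloInformedInitBlock (Φ : (Fin n → ℝ) → (Fin n → ℝ)) : (Fin (n + 1) → ℝ) → (Fin (n + 1) → ℝ) :=
  (soloInformedSplitEquiv n ∘ Prod.map Φ id) ∘ (soloInformedSplitEquiv n).symm

/-- `Θ_Φ z = snoc (Φ (init z)) (last z)`. -/
theorem soloInformed_initBlock_apply (Φ : (Fin n → ℝ) → (Fin n → ℝ)) (z : Fin (n + 1) → ℝ) :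
    soloInformedInitBlock Φ z = Fin.snoc (Φ (Fin.init z)) (z (Fin.last n)) := by
  show soloInformedSplitEquiv n (Prod.map Φ id ((soloInformedSplitEquiv n).symm z)) = _
  rw [soloInformed_splitEquiv_symm_apply, Prod.map_apply, soloInformed_splitEquiv_apply, id]

/-- The derivative `A ⊕ 1` of the block map. -/
def soloInformedInitBlockDeriv (A : (Fin n → ℝ) →L[ℝ] (Fin n → ℝ)) :
    (Fin (n + 1) → ℝ) →L[ℝ] (Fin (n + 1) → ℝ) :=
  ((soloInformedSplitEquiv n : ((Fin n → ℝ) × (Fin 1 → ℝ)) →L[ℝ] (Fin (n + 1) → ℝ)).comp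
    (A.prodMap (ContinuousLinearMap.id ℝ (Fin 1 → ℝ)))).comp
    ((soloInformedSplitEquiv n).symm : (Fin (n + 1) → ℝ) →L[ℝ] ((Fin n → ℝ) × (Fin 1 → ℝ)))

/-- `(A ⊕ 1) v = snoc (A (init v)) (last v)`. -/
theorem soloInformed_initBlockDeriv_apply (A : (Fin n → ℝ) →L[ℝ] (Fin n → ℝ)) (v : Fin (n + 1) → ℝ) :
    soloInformedInitBlockDeriv A v = Fin.snoc (A (Fin.init v)) (v (Fin.last n)) := by
  show soloInformedSplitEquiv n
      (A.prodMap (ContinuousLinearMap.id ℝ (Fin 1 → ℝ)) ((soloInformedSplitEquiv n).symm v)) = _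
  rw [soloInformed_splitEquiv_symm_apply]
  show soloInformedSplitEquiv n (A (Fin.init v), fun _ => v (Fin.last n)) = _
  rw [soloInformed_splitEquiv_apply]

/-- `det (A ⊕ 1) = det A`. -/
theorem soloInformed_det_initBlockDeriv (A : (Fin n → ℝ) →L[ℝ] (Fin n → ℝ)) :
    (soloInformedInitBlockDeriv A).det = A.det := by
  have hcoe : ((soloInformedInitBlockDeriv A : (Fin (n + 1) → ℝ) →L[ℝ] (Fin (n + 1) → ℝ)) :
      (Fin (n + 1) → ℝ) →ₗ[ℝ] (Fin (n + 1) → ℝ)) =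
    (soloInformedSplitLinearEquiv n : ((Fin n → ℝ) × (Fin 1 → ℝ)) →ₗ[ℝ] (Fin (n + 1) → ℝ)) ∘ₗ
      (((A : (Fin n → ℝ) →L[ℝ] (Fin n → ℝ)) : (Fin n → ℝ) →ₗ[ℝ] (Fin n → ℝ)).prodMap
        (LinearMap.id : (Fin 1 → ℝ) →ₗ[ℝ] (Fin 1 → ℝ))) ∘ₗ
      ((soloInformedSplitLinearEquiv n).symm :
        (Fin (n + 1) → ℝ) →ₗ[ℝ] ((Fin n → ℝ) × (Fin 1 → ℝ))) :=
    LinearMap.ext fun v => rfl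
  change LinearMap.det _ = LinearMap.det _
  rw [hcoe, LinearMap.det_conj, LinearMap.det_prodMap, LinearMap.det_id, mul_one]

/-- Chain rule for the block map: if `Φ` has derivative `A` at `init z` then `Θ_Φ` has derivative
`A ⊕ 1` at `z`. -/
theorem soloInformed_hasFDerivAt_initBlock {Φ : (Fin n → ℝ) → (Fin n → ℝ)}
    {A : (Fin n → ℝ) →L[ℝ] (Fin n → ℝ)} {z : Fin (n + 1) → ℝ} (hΦ : HasFDerivAt Φ A (Fin.init z)) :
    HasFDerivAt (soloInformedInitBlock Φ) (soloInformedInitBlockDeriv A) z := by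
  have h1 : HasFDerivAt (Prod.map Φ id) (A.prodMap (ContinuousLinearMap.id ℝ (Fin 1 → ℝ)))
      ((soloInformedSplitEquiv n).symm z) := by
    refine HasFDerivAt.prodMap _ ?_ (hasFDerivAt_id _)
    rw [soloInformed_splitEquiv_symm_apply]
    exact hΦ
  have h2 := ((soloInformedSplitEquiv n).comp_hasFDerivAt_iff).mpr h1
  exact ((soloInformedSplitEquiv n).symm.comp_right_hasFDerivAt_iff).mpr h2

/-! ### The fibre scaling `(x, t) ↦ t · h x` -/

/-- `Fin.init` as a continuous linear map `ℝⁿ⁺¹ → ℝⁿ`. -/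
def soloInformedInitCLM (n : ℕ) : (Fin (n + 1) → ℝ) →L[ℝ] (Fin n → ℝ) :=
  ContinuousLinearMap.pi fun i : Fin n =>
    ContinuousLinearMap.proj (R := ℝ) (φ := fun _ : Fin (n + 1) => ℝ) (Fin.castSucc i)

/-- `soloInformedInitCLM n z = init z`. -/
theorem soloInformed_initCLM_apply (z : Fin (n + 1) → ℝ) : soloInformedInitCLM n z = Fin.init z :=
  rfl

/-- The fibre scaling function `(x, t) ↦ t · h x`. -/
def soloInformedFibreScale (h : (Fin n → ℝ) → ℝ) (z : Fin (n + 1) → ℝ) : ℝ :=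
  z (Fin.last n) * h (Fin.init z)

/-- The derivative of the fibre scaling at `z`: `v ↦ last z · h'(init v) + h (init z) · last v`. -/
def soloInformedFibreScaleDeriv (h : (Fin n → ℝ) → ℝ) (h' : (Fin n → ℝ) →L[ℝ] ℝ)
    (z : Fin (n + 1) → ℝ) : (Fin (n + 1) → ℝ) →L[ℝ] ℝ :=
  z (Fin.last n) • h'.comp (soloInformedInitCLM n) +
    h (Fin.init z) • ContinuousLinearMap.proj (R := ℝ) (φ := fun _ : Fin (n + 1) => ℝ) (Fin.last n)

/-- Product rule: the fibre scaling is differentiable where `h` is. -/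
theorem soloInformed_hasFDerivAt_fibreScale {h : (Fin n → ℝ) → ℝ} {h' : (Fin n → ℝ) →L[ℝ] ℝ}
    {z : Fin (n + 1) → ℝ} (hh : HasFDerivAt h h' (Fin.init z)) :
    HasFDerivAt (soloInformedFibreScale h) (soloInformedFibreScaleDeriv h h' z) z := by
  have h1 : HasFDerivAt (fun y : Fin (n + 1) → ℝ => y (Fin.last n))
      (ContinuousLinearMap.proj (R := ℝ) (φ := fun _ : Fin (n + 1) => ℝ) (Fin.last n)) z :=
    (ContinuousLinearMap.proj (R := ℝ) (φ := fun _ : Fin (n + 1) => ℝ) (Fin.last n)).hasFDerivAt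
  have hh' : HasFDerivAt h h' (soloInformedInitCLM n z) := hh
  have h2 : HasFDerivAt (fun y : Fin (n + 1) → ℝ => h (Fin.init y)) (h'.comp (soloInformedInitCLM n))
      z := hh'.comp z (soloInformedInitCLM n).hasFDerivAt
  exact h1.mul h2

/-- The derivative of the fibre scaling in the vertical direction is `h (init z)`. -/
theorem soloInformed_fibreScaleDeriv_single (h : (Fin n → ℝ) → ℝ) (h' : (Fin n → ℝ) →L[ℝ] ℝ)
    (z : Fin (n + 1) → ℝ) :
    soloInformedFibreScaleDeriv h h' z (Pi.single (Fin.last n) 1) = h (Fin.init z) := by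
  have h0 : Fin.init (Pi.single (Fin.last n) (1 : ℝ) : Fin (n + 1) → ℝ) = 0 := by
    funext i
    simp [Fin.init, (Fin.castSucc_lt_last i).ne]
  simp [soloInformedFibreScaleDeriv, soloInformed_initCLM_apply, h0]

/-! ### The composite `Ψ(x, t) = (Φ x, t · h x)` -/

/-- **The fibre scaling map** `Ψ_{Φ,h} (x, t) := (Φ x, t · h x)`. -/
def soloInformedFibreMap (Φ : (Fin n → ℝ) → (Fin n → ℝ)) (h : (Fin n → ℝ) → ℝ)
    (z : Fin (n + 1) → ℝ) : Fin (n + 1) → ℝ :=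
  Fin.snoc (Φ (Fin.init z)) (z (Fin.last n) * h (Fin.init z))

/-- `init (Ψ z) = Φ (init z)`. -/
theorem soloInformed_init_fibreMap (Φ : (Fin n → ℝ) → (Fin n → ℝ)) (h : (Fin n → ℝ) → ℝ)
    (z : Fin (n + 1) → ℝ) : Fin.init (soloInformedFibreMap Φ h z) = Φ (Fin.init z) :=
  Fin.init_snoc _ _

/-- `last (Ψ z) = last z · h (init z)`. -/
theorem soloInformed_fibreMap_apply_last (Φ : (Fin n → ℝ) → (Fin n → ℝ)) (h : (Fin n → ℝ) → ℝ)
    (z : Fin (n + 1) → ℝ) :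
    soloInformedFibreMap Φ h z (Fin.last n) = z (Fin.last n) * h (Fin.init z) :=
  Fin.snoc_last _ _

/-- The first coordinates of `Ψ z` are those of `Φ (init z)`. -/
theorem soloInformed_fibreMap_apply_castSucc (Φ : (Fin n → ℝ) → (Fin n → ℝ)) (h : (Fin n → ℝ) → ℝ)
    (z : Fin (n + 1) → ℝ) (i : Fin n) :
    soloInformedFibreMap Φ h z (Fin.castSucc i) = Φ (Fin.init z) i :=
  Fin.snoc_castSucc (α := fun _ => ℝ) _ _ _

/-- `Ψ = Θ_Φ ∘ (last-coordinate substitution by the fibre scaling)`. -/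
theorem soloInformed_fibreMap_eq_comp (Φ : (Fin n → ℝ) → (Fin n → ℝ)) (h : (Fin n → ℝ) → ℝ) :
    soloInformedFibreMap Φ h =
      soloInformedInitBlock Φ ∘ soloInformedLastSubst (soloInformedFibreScale h) := by
  funext z
  rw [comp_apply, soloInformed_initBlock_apply, soloInformed_init_lastSubst,
    soloInformed_lastSubst_apply_last]
  rfl

/-- The derivative of `Ψ_{Φ,h}` at `z`, given the derivative `A` of `Φ` and `h'` of `h` at
`init z`: `(A ⊕ 1) ∘ D(fibre scaling)`. -/
def soloInformedFibreMapDeriv (A : (Fin n → ℝ) →L[ℝ] (Fin n → ℝ)) (h : (Fin n → ℝ) → ℝ)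
    (h' : (Fin n → ℝ) →L[ℝ] ℝ) (z : Fin (n + 1) → ℝ) : (Fin (n + 1) → ℝ) →L[ℝ] (Fin (n + 1) → ℝ) :=
  (soloInformedInitBlockDeriv A).comp
    (soloInformedLastSubstDeriv (soloInformedFibreScaleDeriv h h' z))

/-- **Chain rule for `Ψ`.** -/
theorem soloInformed_hasFDerivAt_fibreMap {Φ : (Fin n → ℝ) → (Fin n → ℝ)}
    {A : (Fin n → ℝ) →L[ℝ] (Fin n → ℝ)} {h : (Fin n → ℝ) → ℝ} {h' : (Fin n → ℝ) →L[ℝ] ℝ}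
    {z : Fin (n + 1) → ℝ} (hΦ : HasFDerivAt Φ A (Fin.init z)) (hh : HasFDerivAt h h' (Fin.init z)) :
    HasFDerivAt (soloInformedFibreMap Φ h) (soloInformedFibreMapDeriv A h h' z) z := by
  rw [soloInformed_fibreMap_eq_comp]
  have h1 : HasFDerivAt (soloInformedLastSubst (soloInformedFibreScale h))
      (soloInformedLastSubstDeriv (soloInformedFibreScaleDeriv h h' z)) z :=
    hasFDerivWithinAt_univ.mp
      (soloInformed_hasFDerivWithinAt_lastSubst
        (soloInformed_hasFDerivAt_fibreScale hh).hasFDerivWithinAt)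
  have h2 : HasFDerivAt (soloInformedInitBlock Φ) (soloInformedInitBlockDeriv A)
      (soloInformedLastSubst (soloInformedFibreScale h) z) := by
    apply soloInformed_hasFDerivAt_initBlock
    rw [soloInformed_init_lastSubst]
    exact hΦ
  exact h2.comp z h1

/-- **Determinant of `DΨ`**: `det = det A · h (init z)` (block lower-triangular). -/
theorem soloInformed_det_fibreMapDeriv (A : (Fin n → ℝ) →L[ℝ] (Fin n → ℝ)) (h : (Fin n → ℝ) → ℝ)
    (h' : (Fin n → ℝ) →L[ℝ] ℝ) (z : Fin (n + 1) → ℝ) :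
    (soloInformedFibreMapDeriv A h h' z).det = A.det * h (Fin.init z) := by
  have hmul : (soloInformedFibreMapDeriv A h h' z).det = (soloInformedInitBlockDeriv A).det *
      (soloInformedLastSubstDeriv (soloInformedFibreScaleDeriv h h' z)).det :=
    LinearMap.det_comp _ _
  rw [hmul, soloInformed_det_initBlockDeriv, soloInformed_det_lastSubstDeriv',
    soloInformed_fibreScaleDeriv_single]

/-- **`|det DΨ| = 1`** for the Jacobian scaling `h = |det Φ'|⁻¹` at a non-degenerate point. -/
theorem soloInformed_abs_det_fibreMapDeriv_eq_one
    {Φ' : (Fin n → ℝ) → (Fin n → ℝ) →L[ℝ] (Fin n → ℝ)} (h' : (Fin n → ℝ) →L[ℝ] ℝ)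
    (z : Fin (n + 1) → ℝ) (hz : (Φ' (Fin.init z)).det ≠ 0) :
    |(soloInformedFibreMapDeriv (Φ' (Fin.init z)) (fun x => |(Φ' x).det|⁻¹) h' z).det| = 1 := by
  rw [soloInformed_det_fibreMapDeriv, abs_mul, abs_inv, abs_abs, mul_inv_cancel₀ (abs_ne_zero.mpr hz)]

/-- **Injectivity of `Ψ`** over a set on which `Φ` is injective and `h` does not vanish. -/
theorem soloInformed_injOn_fibreMap {Φ : (Fin n → ℝ) → (Fin n → ℝ)} {h : (Fin n → ℝ) → ℝ}
    {σ : Set (Fin n → ℝ)} {S : Set (Fin (n + 1) → ℝ)} (hinj : InjOn Φ σ) (hh : ∀ x ∈ σ, h x ≠ 0)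
    (hS : S ⊆ {z | Fin.init z ∈ σ}) : InjOn (soloInformedFibreMap Φ h) S := by
  intro z hz w hw he
  have h1 := congrArg Fin.init he
  rw [soloInformed_init_fibreMap, soloInformed_init_fibreMap] at h1
  have h2 : Fin.init z = Fin.init w := hinj (hS hz) (hS hw) h1
  have h3 := congrFun he (Fin.last n)
  rw [soloInformed_fibreMap_apply_last, soloInformed_fibreMap_apply_last, h2] at h3
  have h4 : z (Fin.last n) = w (Fin.last n) := mul_right_cancel₀ (hh _ (hS hw)) h3
  rw [← Fin.snoc_init_self z, ← Fin.snoc_init_self w, h2, h4]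

/-- **`Ψ` is `ℚ`-semialgebraic** on a `ℚ`-semialgebraic set over a set where `Φ` and `h` are.
[BCR 1998, Prop. 2.2.6] -/
theorem soloInformed_isSemialgebraicMapOn_fibreMap {Φ : (Fin n → ℝ) → (Fin n → ℝ)}
    {h : (Fin n → ℝ) → ℝ} {σ : Set (Fin n → ℝ)} {S : Set (Fin (n + 1) → ℝ)}
    (hσ : IsSemialgebraic ℚ σ) (hΦ : IsSemialgebraicMapOn ℚ σ Φ) (hh : IsSemialgebraicFunOn ℚ σ h)
    (hS : IsSemialgebraic ℚ S) (hSσ : S ⊆ {z | Fin.init z ∈ σ}) :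
    IsSemialgebraicMapOn ℚ S (soloInformedFibreMap Φ h) := by
  refine IsSemialgebraicMapOn.of_forall hS fun j => ?_
  induction j using Fin.lastCases with
  | last =>
    have e : (fun z => soloInformedFibreMap Φ h z (Fin.last n)) =
        fun z => z (Fin.last n) * h (Fin.init z) :=
      funext fun z => soloInformed_fibreMap_apply_last Φ h z
    rw [e]
    exact IsSemialgebraicFunOn.mul_holds (isSemialgebraicFunOn_apply hS (Fin.last n))
      (hh.comp_init.mono hSσ hS)
  | cast i =>
    have e : (fun z => soloInformedFibreMap Φ h z (Fin.castSucc i)) = fun z => Φ (Fin.init z) i :=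
      funext fun z => soloInformed_fibreMap_apply_castSucc Φ h z i
    rw [e]
    exact (((isSemialgebraicMapOn_iff_forall_holds hσ).mp hΦ i).comp_init).mono hSσ hS

/-- **The image of a region under a graph.**  If `f x = g (Φ x) · (h x)⁻¹` with `h > 0` on `P` then
`Ψ_{Φ,h}` carries `{(x,t) | x ∈ P, 0 ≤ t ≤ f x}` onto `{(y,s) | y ∈ Φ '' P, 0 ≤ s ≤ g y}`. -/
theorem soloInformed_fibreMap_image_under {Φ : (Fin n → ℝ) → (Fin n → ℝ)} {h : (Fin n → ℝ) → ℝ}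
    {f g : (Fin n → ℝ) → ℝ} {P : Set (Fin n → ℝ)} (hpos : ∀ x ∈ P, 0 < h x)
    (hfg : ∀ x ∈ P, f x * h x = g (Φ x)) :
    soloInformedFibreMap Φ h '' {z : Fin (n + 1) → ℝ | Fin.init z ∈ P ∧ 0 ≤ z (Fin.last n) ∧
        z (Fin.last n) ≤ f (Fin.init z)} =
      {w : Fin (n + 1) → ℝ | Fin.init w ∈ Φ '' P ∧ 0 ≤ w (Fin.last n) ∧
        w (Fin.last n) ≤ g (Fin.init w)} := by
  ext w
  simp only [mem_image, mem_setOf_eq]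
  constructor
  · rintro ⟨z, ⟨hx, h0, hf⟩, rfl⟩
    rw [soloInformed_init_fibreMap, soloInformed_fibreMap_apply_last]
    refine ⟨⟨Fin.init z, hx, rfl⟩, mul_nonneg h0 (hpos _ hx).le, ?_⟩
    rw [← hfg _ hx]
    exact mul_le_mul_of_nonneg_right hf (hpos _ hx).le
  · rintro ⟨⟨x, hx, hxw⟩, h0, hg⟩
    refine ⟨Fin.snoc x (w (Fin.last n) * (h x)⁻¹), ⟨?_, ?_, ?_⟩, ?_⟩
    · simpa using hx
    · simpa using mul_nonneg h0 (inv_nonneg.mpr (hpos x hx).le)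
    · simp only [Fin.init_snoc, Fin.snoc_last]
      rw [← hxw, ← hfg x hx] at hg
      calc w (Fin.last n) * (h x)⁻¹ ≤ f x * h x * (h x)⁻¹ :=
            mul_le_mul_of_nonneg_right hg (inv_nonneg.mpr (hpos x hx).le)
        _ = f x := mul_inv_cancel_right₀ (hpos x hx).ne' _
    · unfold soloInformedFibreMap
      rw [Fin.init_snoc, Fin.snoc_last, inv_mul_cancel_right₀ (hpos x hx).ne', hxw, Fin.snoc_init_self]

end Summit.KontsevichZagierPeriods.KontsevichZagierPeriods.Theorems

end
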